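import Summits.PneNP.PneNP.Theses.PlantedClique
import Literature.Computability.Complexity.Transducers
import Literature.Computability.Complexity.RandomizedProofs

/-!
# Crux `PlantedClique.PlantedcliqueIndistinguishable` (stmt-PneNP-8684) — negative side

Refuter's crux-attack by-products (route PneNP/PlantedClique, decl
`Summit.PneNP.PneNP.Theses.PlantedClique.PlantedcliqueIndistinguishable`, the Planted Clique
conjecture in the weak-detection form of Brennan–Bresler–Huleihel, arXiv:1806.07508 Conj. 2.1).

* `plantedcliqueIndistinguishable_false_without_admissible` — LOAD-BEARING ANALYSIS: the
  clique-size restriction `∃ ε > 0, k n ≤ n^{1/2−ε}` eventually cannot be dropped (the crux with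
  that hypothesis deleted, stated inline, is refuted). Witness: `k = id` (the whole vertex set is planted, the graph is `Kₙ`) against the
  coin-free COMPLETENESS TEST `cTest` ("every adjacency bit is `1`"), a four-state finite-state
  transduction of the machine input `boolPair 1ⁿ (encodeEdgeVec G)`, hence PPT
  (`FST.polyTimeComputable_eval`, `RandAlg.IsPolyTime.ofDet_holds`): its type-II error at `k = id`
  is `0` and its type-I error is `Pr[G(n,1/2) = Kₙ] = 2^{-C(n,2)} ≤ 1/2` for `n ≥ 2`, so
  type-I + type-II `≤ 1/2 < 1 − 1/4` at every `n ≥ 2`. (The sharp boundary — failure already at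
  `k n ≥ c√n` — is the AKS theorem `aks_recovery_holds` plus a clique check; not needed here.)
* `acceptProbOn_ofDet` — the acceptance probability of a coin-free test is the mass of its
  acceptance event (vocabulary check for `typeIError` / `typeIIError`).
* `plantedCliqueDist_eq_of_le_one`, `errSum_eq_one_of_le_one` — SMALL-MODEL FACTS: for `k ≤ 1`
  the planted law is `G(n,1/2)` itself and the two errors of ANY test sum to exactly `1`; so the
  degenerate admissible sizes (`k ≡ 0`, `k ≡ 1`, every witness with `ε > 1/2`) satisfy the crux's
  conclusion with equality — they are consistent instances, not counterexamples, and the bound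
  `1` of the crux is attained.
-/

namespace Summit.PneNP.PneNP.Theorems.PlantedcliqueIndistinguishable.Negative

open Literature.Probability.RandomGraphs.PlantedClique Literature.Computability.Complexity
  Filter Topology Finset
open _root_.Computability (unaryEncodeNat)
open scoped ENNReal

noncomputable section

/-! ## The completeness test: a four-state automaton on the machine input -/

/-- States: inside the doubled unary prefix, after the separator bit `0`, inside the all-ones
suffix (accepting), rejected. [folklore] -/
inductive CSt
  | pre
  | sep
  | suf
  | rej
  deriving DecidableEq, Fintype

/-- Transition function of the completeness automaton. [folklore] -/
def cStep : CSt → Bool → CSt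
  | .pre, true => .pre
  | .pre, false => .sep
  | .sep, true => .suf
  | .sep, false => .rej
  | .suf, true => .suf
  | .suf, false => .rej
  | .rej, _ => .rej

/-- Running the automaton. [folklore] -/
def cRun : CSt → List Bool → CSt
  | s, [] => s
  | s, b :: l => cRun (cStep s b) l

/-- The completeness test on machine inputs: accept iff the run from `pre` ends in `suf`. On
`boolPair 1ⁿ w` this holds iff every bit of `w` is `1` (`completeTest_boolPair`). [folklore] -/
def completeTest (z : List Bool) : Bool := decide (cRun .pre z = .suf)

/-- The reject state is absorbing. [folklore] -/
theorem cRun_rej (l : List Bool) : cRun .rej l = .rej := by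
  induction l with
  | nil => rfl
  | cons b l ih => cases b <;> exact ih

/-- From the accepting state the run stays accepting iff every remaining bit is `1`. [folklore] -/
theorem cRun_suf_iff (l : List Bool) : cRun .suf l = .suf ↔ ∀ b ∈ l, b = true := by
  induction l with
  | nil => simp [cRun]
  | cons b l ih =>
    cases b
    · simp [cRun, cStep, cRun_rej]
    · simp [cRun, cStep, ih]

/-- The doubled unary prefix `(11)ⁿ` of `boolPair 1ⁿ w` is skipped in state `pre`. [folklore] -/
theorem cRun_pre_unary (n : ℕ) (l : List Bool) :
    cRun .pre (((unaryEncodeNat n).flatMap fun b => [b, b]) ++ l) = cRun .pre l := by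
  induction n with
  | zero => rfl
  | succ n ih =>
    simp only [unaryEncodeNat, List.flatMap_cons, List.cons_append, List.nil_append]
    exact ih

/-- On the planted-clique input format the completeness test accepts iff all adjacency bits are
`1`. [folklore] -/
theorem completeTest_boolPair (n : ℕ) (w : List Bool) :
    completeTest (boolPair (unaryEncodeNat n) w) = true ↔ ∀ b ∈ w, b = true := by
  simp only [completeTest, boolPair, decide_eq_true_eq, List.append_assoc]
  rw [cRun_pre_unary]
  exact cRun_suf_iff w

/-- The automaton as a finite-state transducer that emits nothing and prepends its verdict.
[folklore] -/
def cFST : FST CSt Bool Bool where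
  init := .pre
  step s a := (cStep s a, [])
  front s := [decide (s = .suf)]
  keep _ := false

/-- The transducer's state component is the automaton run. [folklore] -/
theorem cFST_run (l : List Bool) (s : CSt) : (cFST.run s l).1 = cRun s l := by
  induction l generalizing s with
  | nil => rfl
  | cons a l ih => exact ih _

/-- The transduction outputs exactly the verdict bit of the completeness test. [folklore] -/
theorem cFST_eval (l : List Bool) : cFST.eval l = [completeTest l] := by
  have h1 : cFST.eval l = [decide ((cFST.run .pre l).1 = .suf)] := rfl
  rw [h1, cFST_run]
  rfl

/-- The completeness test is polynomial-time (indeed linear-time: a finite-state transduction,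
`FST.polyTimeComputable_eval`). [folklore] -/
theorem completeTest_polyTime :
    PolyTimeComputable (id : List Bool → List Bool) (fun b : Bool => [b]) completeTest :=
  PolyTimeComputable.of_encode_eq (f := cFST.eval) (ea := id) (eb := id) id (fun _ => rfl)
    (fun x => by rw [cFST_eval]; rfl) cFST.polyTimeComputable_eval

/-- The coin-free completeness test as a randomized algorithm. [folklore] -/
def cTest : RandAlg (List Bool) Bool := RandAlg.ofDet completeTest

/-- It is a PPT test in the sense of the crux (`T.IsPolyTime id (fun b => [b])`). [folklore] -/
theorem cTest_isPPT : cTest.IsPolyTime id (fun b => [b]) :=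
  RandAlg.IsPolyTime.ofDet_holds completeTest_polyTime

/-! ## Acceptance probabilities of coin-free tests -/

/-- For a coin-free test the acceptance probability on `G ∼ D` is the `D`-mass of the acceptance
event. [folklore] -/
theorem acceptProbOn_ofDet {n : ℕ} (g : List Bool → Bool) (D : PMF (EdgeVec n)) :
    acceptProbOn (RandAlg.ofDet g) D =
      (D.toOuterMeasure {G | g (boolPair (unaryEncodeNat n) (encodeEdgeVec G)) = true}).toReal := by
  rw [acceptProbOn]
  congr 1
  rw [PMF.toOuterMeasure_bind_apply, PMF.toOuterMeasure_apply]
  refine tsum_congr fun G => ?_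
  rw [RandAlg.outputPMF_ofDet, PMF.toOuterMeasure_pure_apply]
  by_cases h : g (boolPair (unaryEncodeNat n) (encodeEdgeVec G)) = true
  · rw [Set.indicator_of_mem (show G ∈ {G : EdgeVec n |
        g (boolPair (unaryEncodeNat n) (encodeEdgeVec G)) = true} from h),
      if_pos (by simpa using h), mul_one]
  · rw [Set.indicator_of_notMem (show G ∉ {G : EdgeVec n |
        g (boolPair (unaryEncodeNat n) (encodeEdgeVec G)) = true} from h),
      if_neg (by simpa using h), mul_zero]

/-! ## The adjacency encoding lists every edge bit -/

/-- Every edge bit `x {i,j}`, `i < j`, occurs in the adjacency encoding. [folklore] -/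
theorem mem_encodeEdgeVec {n : ℕ} (x : EdgeVec n) {i j : Fin n} (h : i < j) :
    x ⟨s(i, j), by simp [h.ne]⟩ ∈ encodeEdgeVec x := by
  simp only [encodeEdgeVec, List.mem_flatMap, List.mem_finRange, true_and, List.mem_filterMap]
  exact ⟨i, j, by rw [dif_pos h]⟩

/-- Conversely every bit of the adjacency encoding is an edge bit `x {i,j}`, `i < j`. [folklore] -/
theorem exists_of_mem_encodeEdgeVec {n : ℕ} {x : EdgeVec n} {b : Bool}
    (hb : b ∈ encodeEdgeVec x) :
    ∃ i j : Fin n, ∃ h : i < j, b = x ⟨s(i, j), by simp [h.ne]⟩ := by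
  simp only [encodeEdgeVec, List.mem_flatMap, List.mem_finRange, true_and,
    List.mem_filterMap] at hb
  obtain ⟨i, j, hij⟩ := hb
  by_cases h : i < j
  · rw [dif_pos h] at hij
    exact ⟨i, j, h, (Option.some_injective _ hij).symm⟩
  · rw [dif_neg h] at hij
    exact absurd hij (by simp)

/-- All adjacency bits are `1` iff the graph is complete. [folklore] -/
theorem forall_mem_encodeEdgeVec_iff {n : ℕ} (x : EdgeVec n) :
    (∀ b ∈ encodeEdgeVec x, b = true) ↔ x = fun _ => true := by
  constructor
  · intro h
    funext e
    obtain ⟨e, he⟩ := e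
    induction e using Sym2.ind with
    | h a b =>
      have hab : a ≠ b := by
        have h' := he
        rwa [SimpleGraph.mem_edgeSet, SimpleGraph.top_adj] at h'
      rcases lt_or_gt_of_ne hab with hlt | hlt
      · exact h _ (mem_encodeEdgeVec x hlt)
      · have hba := h _ (mem_encodeEdgeVec x hlt)
        have heq : (⟨s(a, b), he⟩ : (⊤ : SimpleGraph (Fin n)).edgeSet) =
            ⟨s(b, a), by simp [hlt.ne]⟩ := Subtype.ext Sym2.eq_swap
        rw [heq]
        exact hba
  · rintro rfl b hb
    obtain ⟨i, j, _, rfl⟩ := exists_of_mem_encodeEdgeVec hb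
    rfl

/-! ## Errors of the completeness test -/

/-- At `k = n` the planted graph is `Kₙ`. [folklore] -/
theorem eq_top_of_mem_support_plantedCliqueDist_self {n : ℕ} {G : EdgeVec n}
    (hG : G ∈ (plantedCliqueDist n n).support) : G = fun _ => true := by
  rw [plantedCliqueDist, PMF.support_map] at hG
  obtain ⟨p, hp, rfl⟩ := hG
  obtain ⟨hcard, hclique⟩ := mem_support_plantedCliqueJoint hp
  rw [min_self] at hcard
  have huniv : p.1 = Finset.univ :=
    Finset.eq_univ_of_card _ (by rw [hcard, Fintype.card_fin])
  funext e
  obtain ⟨e, he⟩ := e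
  induction e using Sym2.ind with
  | h a b =>
    have hab : a ≠ b := by
      have h' := he
      rwa [SimpleGraph.mem_edgeSet, SimpleGraph.top_adj] at h'
    have ha : a ∈ (p.1 : Set (Fin n)) := by simp [huniv]
    have hb : b ∈ (p.1 : Set (Fin n)) := by simp [huniv]
    have hadj := hclique ha hb hab
    rw [graphOfEdgeVec_adj] at hadj
    obtain ⟨_, hx⟩ := hadj
    exact hx

/-- Type-II error of the completeness test at `k = id` vanishes identically. [folklore] -/
theorem typeIIError_cTest_self (n : ℕ) : typeIIError cTest (fun m => m) n = 0 := by
  rw [typeIIError, cTest, acceptProbOn_ofDet, sub_eq_zero, eq_comm, ENNReal.toReal_eq_one_iff,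
    PMF.toOuterMeasure_apply_eq_one_iff]
  intro G hG
  show completeTest _ = true
  rw [completeTest_boolPair, forall_mem_encodeEdgeVec_iff]
  exact eq_top_of_mem_support_plantedCliqueDist_self hG

/-- Type-I error of the completeness test: `Pr[G(n,1/2) = Kₙ] ≤ 1/2` for `n ≥ 2`.
[folklore] -/
theorem typeIError_cTest_le {n : ℕ} (hn : 2 ≤ n) : typeIError cTest n ≤ 1 / 2 := by
  rw [typeIError, cTest, acceptProbOn_ofDet]
  have hsub : {G : EdgeVec n | completeTest (boolPair (unaryEncodeNat n) (encodeEdgeVec G)) = true}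
      ⊆ {fun _ => true} := by
    intro G hG
    rw [Set.mem_setOf_eq, completeTest_boolPair, forall_mem_encodeEdgeVec_iff] at hG
    exact hG
  have e₀ : (⊤ : SimpleGraph (Fin n)).edgeSet :=
    ⟨s(⟨0, by omega⟩, ⟨1, by omega⟩), by simp [Fin.ext_iff]⟩
  have hne : (fun _ => true : EdgeVec n) ≠ fun _ => false := fun h => by
    have := congrFun h e₀
    simp at this
  have hcard : (2 : ℝ≥0∞) ≤ Fintype.card (EdgeVec n) := by
    have h2 : 2 ≤ Fintype.card (EdgeVec n) := Fintype.one_lt_card_iff.2 ⟨_, _, hne⟩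
    exact_mod_cast h2
  have hle : (erdosRenyiHalf n).toOuterMeasure
      {G | completeTest (boolPair (unaryEncodeNat n) (encodeEdgeVec G)) = true} ≤ 2⁻¹ := by
    refine ((erdosRenyiHalf n).toOuterMeasure.mono hsub).trans ?_
    show (erdosRenyiHalf n).toOuterMeasure {fun _ => true} ≤ 2⁻¹
    rw [PMF.toOuterMeasure_apply_singleton, erdosRenyiHalf, PMF.uniformOfFintype_apply,
      ENNReal.inv_le_inv]
    exact hcard
  have key := ENNReal.toReal_mono (by simp) hle
  rw [ENNReal.toReal_inv, ENNReal.toReal_ofNat] at key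
  linarith

/-! ## Load-bearing: admissibility cannot be dropped -/

/-- **ANY PROOF OF THE CRUX MUST USE THE CLIQUE-SIZE RESTRICTION.** The negated statement is
`PlantedcliqueIndistinguishable` VERBATIM with the admissibility hypothesis
`∃ ε > 0, ∀ᶠ n, k n ≤ n^{1/2−ε}` dropped (every `k : ℕ → ℕ` allowed; named
`IndistinguishableWithoutAdmissible` in the refuter's work file); it is false: at `k = id` the PPT
completeness test `cTest` has type-I + type-II error `≤ 1/2` at every `n ≥ 2`, so the error sum
is not eventually `≥ 1 − 1/4`. [this work] -/
theorem plantedcliqueIndistinguishable_false_without_admissible :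
    ¬ (∀ k : ℕ → ℕ, ∀ T : RandAlg (List Bool) Bool, T.IsPolyTime id (fun b => [b]) →
        ∀ η : ℝ, 0 < η →
          ∀ᶠ n : ℕ in atTop, 1 - η ≤ typeIError T n + typeIIError T k n) := by
  intro h
  have hev := h (fun m => m) cTest cTest_isPPT (1 / 4) (by norm_num)
  obtain ⟨n, hn, hn2⟩ := (hev.and (eventually_ge_atTop 2)).exists
  have h1 := typeIError_cTest_le hn2
  have h2 := typeIIError_cTest_self n
  linarith

/-! ## Small-model facts: degenerate clique sizes -/

/-- No edge of `Kₙ` has both endpoints in a set with at most one element. [folklore] -/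
theorem not_forall_mem_of_card_le_one {n : ℕ} {S : Finset (Fin n)} (hS : S.card ≤ 1)
    {e : Sym2 (Fin n)} (he : e ∈ (⊤ : SimpleGraph (Fin n)).edgeSet) :
    ¬ ∀ v ∈ e, v ∈ S := by
  induction e using Sym2.ind with
  | h a b =>
    rw [SimpleGraph.mem_edgeSet, SimpleGraph.top_adj] at he
    intro h
    exact he (Finset.card_le_one.1 hS a (h a (Sym2.mem_mk_left a b)) b
      (h b (Sym2.mem_mk_right a b)))

/-- Planting a clique on at most one vertex changes nothing. [folklore] -/
theorem plant_eq_self {n : ℕ} {S : Finset (Fin n)} (hS : S.card ≤ 1) (x : EdgeVec n) :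
    plant S x = x := by
  funext e
  have h := not_forall_mem_of_card_le_one hS e.2
  simp only [plant, h, decide_false, Bool.or_false]

/-- For `k ≤ 1` the planted law `G(n,1/2,k)` IS `G(n,1/2)`. [folklore] -/
theorem plantedCliqueDist_eq_of_le_one {n k : ℕ} (hk : k ≤ 1) :
    plantedCliqueDist n k = erdosRenyiHalf n := by
  have hmin : min k n ≤ 1 := (min_le_left k n).trans hk
  have hS : ∀ S ∈ kSubsets n k,
      ((erdosRenyiHalf n).map fun x => (S, plant S x)).map Prod.snd = erdosRenyiHalf n := by
    intro S hS
    rw [PMF.map_comp]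
    have hcard : S.card ≤ 1 := (card_of_mem_kSubsets hS).le.trans hmin
    have hid : (Prod.snd ∘ fun x => (S, plant S x)) = id := funext fun x => plant_eq_self hcard x
    rw [hid, PMF.map_id]
  unfold plantedCliqueDist plantedCliqueJoint
  rw [PMF.map_bind]
  ext y
  rw [PMF.bind_apply]
  have hfun : (fun S => (PMF.uniformOfFinset (kSubsets n k) (kSubsets_nonempty n k)) S *
      (((erdosRenyiHalf n).map fun x => (S, plant S x)).map Prod.snd) y) =
      fun S => (PMF.uniformOfFinset (kSubsets n k) (kSubsets_nonempty n k)) S *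
        (erdosRenyiHalf n) y := by
    funext S
    by_cases hmem : S ∈ kSubsets n k
    · rw [hS S hmem]
    · simp [PMF.uniformOfFinset_apply, hmem]
  rw [hfun, ENNReal.tsum_mul_right, PMF.tsum_coe, one_mul]

/-- **Tightness at degenerate sizes**: if `k n ≤ 1` the two errors of ANY test (PPT or not) sum
to exactly `1` — the crux's bound `1` is attained, and its degenerate admissible instances
(`k ≡ 0`, `k ≡ 1`, witnesses with `ε > 1/2`) hold with equality. [folklore] -/
theorem errSum_eq_one_of_le_one (T : RandAlg (List Bool) Bool) {k : ℕ → ℕ} {n : ℕ}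
    (hn : k n ≤ 1) : typeIError T n + typeIIError T k n = 1 := by
  rw [typeIError, typeIIError, plantedCliqueDist_eq_of_le_one hn]; ring

/-- Hence the crux's conclusion at every eventually-degenerate `k`, for every test. [folklore] -/
theorem errSum_eventually_ge_of_eventually_le_one (k : ℕ → ℕ)
    (hk : ∀ᶠ n in atTop, k n ≤ 1)
    (T : RandAlg (List Bool) Bool) (η : ℝ) (hη : 0 < η) :
    ∀ᶠ n : ℕ in atTop, 1 - η ≤ typeIError T n + typeIIError T k n := by
  filter_upwards [hk] with n hn
  rw [errSum_eq_one_of_le_one T hn]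
  linarith

end

end Summit.PneNP.PneNP.Theorems.PlantedcliqueIndistinguishable.Negative
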